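import Summits.QuantumFields.YangMills.Theorems.AlphaInputsT3ACv3AbelianLiftAvg
import HarnessLib

/-!
# Line «poincare_lipschitz» on crux `HistoryTailL` (stmt-QuantumFields-19936) — K2's LINEAR SKELETON, ONE STEP:
# the ℓ²(bonds) → curl(coarse plaquette) SCHUR BOUND of Bałaban's (0.4) linear average, gain `√(L²/L^d)` (= `L^{−1/2}` in d = 3)

Cell `ym3-torus` (YM ladder rung R3 = continuum SU(2) Yang–Mills on the three-torus — a RUNG, NOT the Clay problem: not
d = 4, not infinite volume, not a mass gap), width seat `ym-ust-19936-w3` gen 10; helper toward the K2 stubs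
(`stub_levelOneLipschitz` ∕ `stub_iteratedLipschitz`) of the registered skeleton `Cruxes/HistoryTailL/Lines/poincare_lipschitz.lean`,
LINEAR MODEL ONLY.  Route-independent imports (the abelian (0.4) letters of `…AbelianCurl` ∕ `…AbelianStokes` ∕ `…AbelianLocal`
and `TorusGeometry`).  Nothing here proves a stub, the crux `HistoryTailL` or a summit statement.

WHAT.  For a real one-form `a` on the bonds of `T^{(j)}` and a coarse plaquette `(y; μ, ν)` of `T^{(j+1)}`:
* WHY THE CURL AND NOT THE BOND VALUE: ✓`AbelianEML.linAvg04_eq` writes the (0.4) linear average as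
  `stairMean(c₋) − stairMean(c₊) + segMean(c)`; the stair (contour) part is a COBOUNDARY whose first letters out of a block
  centre carry O(1) weight (so NO `ℓ²`-gain for the bond value: `a := 𝟙_{(emb c₋, κ)}` has `‖a‖_{ℓ²} = 1` and
  `linAvg04 a c = O(1)`), and it telescopes around every coarse plaquette (✓`AbelianEML.curl_linAvg04`: the curl is the
  mean over the `|Idx|` transported `L × L` squares of their boundary fluxes).
* `abs_curl_linAvg04_le_sqrt` — ★ `|curl(linAvg04 a)(y; μ, ν)| ≤ 4·√(L²/L^d)·(Σ_b a_b²)^{1/2}`: Cauchy–Schwarz on the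
  boundary form with the EXACT MULTIPLICITY of the transported squares — a fine bond lies on a given side of at most `L` of
  the `L^d` squares `offPt y (off r)` (for a fixed position `s` along the side the offset `r` is determined: `blockSite` and
  the straight shifts are injective, `sum_sum_range_comp_le_of_injective`), so each of the four side families contributes
  `≤ √(L^d·L)·√(L·Σ_b a_b²)/L^d = √(L²/L^d)·‖a‖_{ℓ²}`.
* `abs_curlAt_linAvgIter_le_sqrt` — ★★ THE j-UNIFORM BOUND FOR THE ITERATE: `|curl(linAvgIter k a)(Y; μ, ν)| ≤
  4·√((L^k)²/(L^k)^d)·(Σ_b a_b²)^{1/2}` with the SAME constant `4` at every depth `k` (in d = 3: `4·L^{−k/2}`).  NOT by iterating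
  the one-step bound (curl→curl in `ℓ²` loses `√L` per step) but through the tree's CLOSED FORM of the iterate,
  ✓`AbelianEML.linAvgIter_eq_tubeSum_sub_cobd` (`linAvgIter k a = (L^k)^{−d}·tubeSum k a − cobd Φ`: the k-fold (0.4) average is ONE
  uniform average over the `(L^k)^d` base-`L`-digit translates of the straight tube of length `L^k`, up to a coboundary), whose
  coboundary the curl kills; then the same Cauchy–Schwarz + multiplicity with `L^k` in place of `L` (`bsite_injective`).
USE.  The one-step lemma is the j = 1 case; the iterate is the «tent budget» of the K2 discussion made a kernel letter.  The
registered `stub_levelOneLipschitz` carries exactly the factor `CL/√(L^j)` against `(Σ_b dist1(U_b U'_b⁻¹)²)^{1/2}` on the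
footprint; the present lemma is its linear main term (the whole torus `ℓ²` norm may be replaced by the footprint's by the
locality ✓`AvgIterLocality`, consumer side). [folklore]
-/

set_option autoImplicit false

noncomputable section

namespace Summit.QuantumFields.YangMills.Theorems.PoincareLipschitzLinAvgEll2

open scoped BigOperators Classical
open Literature.MathematicalPhysics.QuantumFieldTheory.Balaban1983to89
open Literature.MathematicalPhysics.QuantumFieldTheory.Balaban1983to89.BlockAveraging (off Idx)
open Literature.MathematicalPhysics.QuantumFieldTheory.Balaban1983to89.BlockAveragingEMLProp2 (shiftN_apply shift_shift_comm)
open Literature.MathematicalPhysics.QuantumFieldTheory.Balaban1983to89.B10Eq47AxialChi (shiftN shiftN_zero shiftN_succ)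
open Summit.QuantumFields.YangMills.Theorems.AbelianEML
  (linAvg04 linAvgIter rectSum runSum squareSum offPt curlAt cobd tubeSum bsite curl_linAvg04 squareSum_eq_rectSum
    rectSum_eq_runSum offPt_off_eq_blockSite val_bsite bsite_shiftN linAvgIter_eq_tubeSum_sub_cobd)

variable {P : Params} {j : ℕ}

/-! ## §1  Injectivity of the straight shifts and of the block parametrisation -/

/-- The block parametrisation `r ↦ blockSite y r` is injective (standing range). [folklore] -/
theorem blockSite_injective (hj : j + 1 ≤ P.m + P.K) (y : Site P (j + 1)) :
    Function.Injective (Site.blockSite y : (Fin P.d → Fin P.L) → Site P j) := by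
  intro r r' h
  funext κ
  apply Fin.ext
  have h1 := congrArg (fun z : Site P j => (z κ).val) h
  simp only [Site.val_blockSite hj] at h1
  omega

/-- A bond is determined by its initial point once the direction is fixed. [folklore] -/
theorem bond_mk_injective (μ : Fin P.d) : Function.Injective fun x : Site P j => (⟨x, μ⟩ : PBond P j) := by
  intro x x' h
  simpa using congrArg PBond.src h

/-! ## §2  Multiplicity: a double sum over (offset, position) of a non-negative bond function -/

/-- **MULTIPLICITY LEMMA.**  If for every position `s` the map `r ↦ φ r s` is injective, then
`Σ_r Σ_{s<m} g(φ r s) ≤ m · Σ_b g b` for every non-negative `g` (each bond is hit at most once per position). [folklore] -/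
theorem sum_sum_range_comp_le_of_injective {ι β : Type*} [Fintype ι] [Fintype β] (g : β → ℝ) (hg : ∀ b, 0 ≤ g b)
    (φ : ι → ℕ → β) (hφ : ∀ s, Function.Injective fun r => φ r s) (m : ℕ) :
    ∑ r, ∑ s ∈ Finset.range m, g (φ r s) ≤ (m : ℝ) * ∑ b, g b := by
  rw [Finset.sum_comm]
  have hstep : ∀ s ∈ Finset.range m, ∑ r, g (φ r s) ≤ ∑ b, g b := by
    intro s _
    have h1 : ∑ r, g (φ r s) = ∑ b ∈ Finset.univ.image (fun r => φ r s), g b := by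
      rw [Finset.sum_image (fun r _ r' _ h => hφ s h)]
    rw [h1]
    exact Finset.sum_le_sum_of_subset_of_nonneg (Finset.subset_univ _) fun b _ _ => hg b
  calc ∑ s ∈ Finset.range m, ∑ r, g (φ r s) ≤ ∑ s ∈ Finset.range m, ∑ b, g b := Finset.sum_le_sum hstep
    _ = (m : ℝ) * ∑ b, g b := by rw [Finset.sum_const, Finset.card_range, nsmul_eq_mul]

/-- **ONE SIDE FAMILY, CAUCHY–SCHWARZ + MULTIPLICITY.**  `Σ_r Σ_{s<m} |a(φ r s)| ≤ √(#ι·m)·√(m·Σ_b a_b²)`. [folklore] -/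
theorem sum_sum_abs_le_sqrt {ι β : Type*} [Fintype ι] [Fintype β] (a : β → ℝ)
    (φ : ι → ℕ → β) (hφ : ∀ s, Function.Injective fun r => φ r s) (m : ℕ) :
    ∑ r, ∑ s ∈ Finset.range m, |a (φ r s)| ≤
      Real.sqrt ((Fintype.card ι : ℝ) * m) * Real.sqrt ((m : ℝ) * ∑ b, a b ^ 2) := by
  -- flatten the double sum over the product finset
  have hflat : ∑ r, ∑ s ∈ Finset.range m, |a (φ r s)| =
      ∑ p ∈ (Finset.univ : Finset ι) ×ˢ Finset.range m, |a (φ p.1 p.2)| := by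
    rw [Finset.sum_product]
  have hflat2 : ∑ r, ∑ s ∈ Finset.range m, a (φ r s) ^ 2 =
      ∑ p ∈ (Finset.univ : Finset ι) ×ˢ Finset.range m, a (φ p.1 p.2) ^ 2 := by
    rw [Finset.sum_product]
  have hcard : (((Finset.univ : Finset ι) ×ˢ Finset.range m).card : ℝ) = (Fintype.card ι : ℝ) * m := by
    rw [Finset.card_product, Finset.card_univ, Finset.card_range, Nat.cast_mul]
  -- Cauchy–Schwarz `(Σ |a|)² ≤ #·Σ |a|²`
  have hCS := sq_sum_le_card_mul_sum_sq (s := (Finset.univ : Finset ι) ×ˢ Finset.range m) (f := fun p => |a (φ p.1 p.2)|)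
  simp only [sq_abs] at hCS
  rw [hcard, ← hflat, ← hflat2] at hCS
  -- multiplicity on the square sum
  have hmult := sum_sum_range_comp_le_of_injective (fun b => a b ^ 2) (fun b => sq_nonneg _) φ hφ m
  have hS0 : 0 ≤ ∑ r, ∑ s ∈ Finset.range m, |a (φ r s)| :=
    Finset.sum_nonneg fun r _ => Finset.sum_nonneg fun s _ => abs_nonneg _
  have hA0 : 0 ≤ (Fintype.card ι : ℝ) * m := by positivity
  have hsq : (∑ r, ∑ s ∈ Finset.range m, |a (φ r s)|) ^ 2 ≤
      ((Fintype.card ι : ℝ) * m) * ((m : ℝ) * ∑ b, a b ^ 2) :=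
    hCS.trans (mul_le_mul_of_nonneg_left hmult hA0)
  calc ∑ r, ∑ s ∈ Finset.range m, |a (φ r s)|
      = Real.sqrt ((∑ r, ∑ s ∈ Finset.range m, |a (φ r s)|) ^ 2) := (Real.sqrt_sq hS0).symm
    _ ≤ Real.sqrt (((Fintype.card ι : ℝ) * m) * ((m : ℝ) * ∑ b, a b ^ 2)) := Real.sqrt_le_sqrt hsq
    _ = Real.sqrt ((Fintype.card ι : ℝ) * m) * Real.sqrt ((m : ℝ) * ∑ b, a b ^ 2) := Real.sqrt_mul hA0 _

/-! ## §3  The one-step Schur bound for the curl of the (0.4) linear average -/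

/-- `|runSum| ≤ Σ |a|` along the run. [folklore] -/
theorem abs_runSum_le (a : PBond P j → ℝ) (x : Site P j) (μ : Fin P.d) (m : ℕ) :
    |runSum a x μ m| ≤ ∑ s ∈ Finset.range m, |a ⟨shiftN x μ s, μ⟩| :=
  Finset.abs_sum_le_sum_abs _ _

/-- The four sides of the transported square at offset `r`, as (offset, position) ↦ bond maps; each is injective in the
offset at fixed position (standing range). [folklore] -/
theorem sides_injective (hj : j + 1 ≤ P.m + P.K) (y : Site P (j + 1)) (μ ν : Fin P.d) (s : ℕ) :
    (Function.Injective fun r : Fin P.d → Fin P.L => (⟨shiftN (Site.blockSite y r) μ s, μ⟩ : PBond P j)) ∧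
    (Function.Injective fun r : Fin P.d → Fin P.L =>
      (⟨shiftN (shiftN (Site.blockSite y r) μ P.L) ν s, ν⟩ : PBond P j)) ∧
    (Function.Injective fun r : Fin P.d → Fin P.L =>
      (⟨shiftN (shiftN (Site.blockSite y r) ν P.L) μ s, μ⟩ : PBond P j)) ∧
    (Function.Injective fun r : Fin P.d → Fin P.L => (⟨shiftN (Site.blockSite y r) ν s, ν⟩ : PBond P j)) := by
  have hb := blockSite_injective hj y
  -- the straight shifts are injective (tree: `SFWGaussianRung.shiftN_left_injective`, inlined to keep the imports light)
  have shiftN_injective : ∀ (κ : Fin P.d) (t : ℕ), Function.Injective fun x : Site P j => shiftN x κ t := by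
    intro κ t x x' h
    funext ι
    have h1 := congrArg (fun z : Site P j => z ι) h
    simp only [shiftN_apply] at h1
    exact add_right_cancel h1
  refine ⟨?_, ?_, ?_, ?_⟩
  · exact (bond_mk_injective μ).comp ((shiftN_injective μ s).comp hb)
  · exact (bond_mk_injective ν).comp ((shiftN_injective ν s).comp ((shiftN_injective μ P.L).comp hb))
  · exact (bond_mk_injective μ).comp ((shiftN_injective μ s).comp ((shiftN_injective ν P.L).comp hb))
  · exact (bond_mk_injective ν).comp ((shiftN_injective ν s).comp hb)

/-- `|Idx| = L^d · |Perm × Perm|`. [folklore] -/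
theorem card_Idx : (Fintype.card (Idx P) : ℝ) =
    ((P.L : ℝ) ^ P.d) * (Fintype.card (Equiv.Perm (Fin P.d) × Equiv.Perm (Fin P.d)) : ℝ) := by
  have h : Fintype.card (Idx P) =
      Fintype.card (Fin P.d → Fin P.L) * Fintype.card (Equiv.Perm (Fin P.d) × Equiv.Perm (Fin P.d)) :=
    Fintype.card_prod _ _
  rw [h, Fintype.card_fun, Fintype.card_fin, Fintype.card_fin]
  push_cast
  ring

/-- **★ THE ONE-STEP SCHUR BOUND (linear model of K2 at one averaging step).**  For every real one-form `a` on the bonds of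
`T^{(j)}` and every coarse plaquette `(y; μ, ν)` (standing range `j + 1 ≤ m + K`):
`|curl(linAvg04 a)(y; μ, ν)| ≤ 4·√(L²/L^d)·(Σ_b a_b²)^{1/2}` — in `d = 3` the gain is `4/√L`. [folklore] -/
theorem abs_curl_linAvg04_le_sqrt (hj : j + 1 ≤ P.m + P.K) (a : PBond P j → ℝ) (y : Site P (j + 1)) (μ ν : Fin P.d) :
    |linAvg04 a ⟨y, μ⟩ + linAvg04 a ⟨y.shift μ, ν⟩ - linAvg04 a ⟨y.shift ν, μ⟩ - linAvg04 a ⟨y, ν⟩| ≤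
      4 * Real.sqrt ((P.L : ℝ) ^ 2 / (P.L : ℝ) ^ P.d) * Real.sqrt (∑ b : PBond P j, a b ^ 2) := by
  rw [curl_linAvg04]
  -- letters
  set Npp : ℝ := (Fintype.card (Equiv.Perm (Fin P.d) × Equiv.Perm (Fin P.d)) : ℝ) with hNpp
  set Ld : ℝ := (P.L : ℝ) ^ P.d with hLd
  set S : ℝ := ∑ b : PBond P j, a b ^ 2 with hS
  have hL0 : (0 : ℝ) < P.L := by exact_mod_cast P.L_pos
  have hLd0 : 0 < Ld := by rw [hLd]; positivity
  have hNpp0 : 0 < Npp := by rw [hNpp]; exact_mod_cast Fintype.card_pos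
  have hS0 : 0 ≤ S := Finset.sum_nonneg fun b _ => sq_nonneg _
  have hcard : (Fintype.card (Idx P) : ℝ) = Ld * Npp := card_Idx
  -- the four side families
  set φ1 : (Fin P.d → Fin P.L) → ℕ → PBond P j := fun r s => ⟨shiftN (Site.blockSite y r) μ s, μ⟩ with hφ1
  set φ2 : (Fin P.d → Fin P.L) → ℕ → PBond P j :=
    fun r s => ⟨shiftN (shiftN (Site.blockSite y r) μ P.L) ν s, ν⟩ with hφ2
  set φ3 : (Fin P.d → Fin P.L) → ℕ → PBond P j :=
    fun r s => ⟨shiftN (shiftN (Site.blockSite y r) ν P.L) μ s, μ⟩ with hφ3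
  set φ4 : (Fin P.d → Fin P.L) → ℕ → PBond P j := fun r s => ⟨shiftN (Site.blockSite y r) ν s, ν⟩ with hφ4
  -- each transported square flux is bounded by its four sides
  have hsq : ∀ r : Fin P.d → Fin P.L, |squareSum a y (off r) μ ν| ≤
      (∑ s ∈ Finset.range P.L, |a (φ1 r s)|) + (∑ s ∈ Finset.range P.L, |a (φ2 r s)|) +
      (∑ s ∈ Finset.range P.L, |a (φ3 r s)|) + (∑ s ∈ Finset.range P.L, |a (φ4 r s)|) := by
    intro r
    rw [squareSum_eq_rectSum, offPt_off_eq_blockSite, rectSum_eq_runSum]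
    have h1 := abs_runSum_le a (Site.blockSite y r) μ P.L
    have h2 := abs_runSum_le a (shiftN (Site.blockSite y r) μ P.L) ν P.L
    have h3 := abs_runSum_le a (shiftN (Site.blockSite y r) ν P.L) μ P.L
    have h4 := abs_runSum_le a (Site.blockSite y r) ν P.L
    calc |runSum a (Site.blockSite y r) μ P.L + runSum a (shiftN (Site.blockSite y r) μ P.L) ν P.L -
          runSum a (shiftN (Site.blockSite y r) ν P.L) μ P.L - runSum a (Site.blockSite y r) ν P.L|
        ≤ |runSum a (Site.blockSite y r) μ P.L| + |runSum a (shiftN (Site.blockSite y r) μ P.L) ν P.L| +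
          |runSum a (shiftN (Site.blockSite y r) ν P.L) μ P.L| + |runSum a (Site.blockSite y r) ν P.L| := by
          -- `|A + B - C - D| ≤ |A| + |B| + |C| + |D|`
          have : ∀ A B C D : ℝ, |A + B - C - D| ≤ |A| + |B| + |C| + |D| := fun A B C D => by
            have := abs_add_le (A + B - C) (-D)
            have := abs_add_le (A + B) (-C)
            have := abs_add_le A B
            simp only [abs_neg, ← sub_eq_add_neg] at *
            linarith
          exact this _ _ _ _
      _ ≤ _ := by
          simp only [hφ1, hφ2, hφ3, hφ4]
          linarith [h1, h2, h3, h4]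
  -- the family bounds (Cauchy–Schwarz + multiplicity)
  have hcardι : (Fintype.card (Fin P.d → Fin P.L) : ℝ) = Ld := by
    rw [hLd, Fintype.card_fun, Fintype.card_fin, Fintype.card_fin]; push_cast; ring
  have hfam : ∀ φ : (Fin P.d → Fin P.L) → ℕ → PBond P j, (∀ s, Function.Injective fun r => φ r s) →
      ∑ r, ∑ s ∈ Finset.range P.L, |a (φ r s)| ≤ Real.sqrt (Ld * P.L) * Real.sqrt ((P.L : ℝ) * S) := by
    intro φ hφ
    have h := sum_sum_abs_le_sqrt a φ hφ P.L
    rwa [hcardι] at h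
  obtain ⟨i1, i2, i3, i4⟩ : (∀ s, Function.Injective fun r => φ1 r s) ∧ (∀ s, Function.Injective fun r => φ2 r s) ∧
      (∀ s, Function.Injective fun r => φ3 r s) ∧ (∀ s, Function.Injective fun r => φ4 r s) :=
    ⟨fun s => (sides_injective hj y μ ν s).1, fun s => (sides_injective hj y μ ν s).2.1,
      fun s => (sides_injective hj y μ ν s).2.2.1, fun s => (sides_injective hj y μ ν s).2.2.2⟩
  have hF1 := hfam φ1 i1
  have hF2 := hfam φ2 i2
  have hF3 := hfam φ3 i3
  have hF4 := hfam φ4 i4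
  -- assemble: `|card⁻¹ Σ_i sq_i| ≤ card⁻¹ · Npp · Σ_r |sq_r| ≤ Ld⁻¹ · 4 · √(Ld L) √(L S)`
  have hsum : |∑ i : Idx P, squareSum a y (off i.1) μ ν| ≤ Npp * (4 * (Real.sqrt (Ld * P.L) * Real.sqrt ((P.L : ℝ) * S))) := by
    calc |∑ i : Idx P, squareSum a y (off i.1) μ ν| ≤ ∑ i : Idx P, |squareSum a y (off i.1) μ ν| :=
          Finset.abs_sum_le_sum_abs _ _
      _ = Npp * ∑ r, |squareSum a y (off r) μ ν| := by
          -- a sum over `Idx` of a function of the offset alone (tree: `NE7.sum_idx_of_fst`, inlined)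
          rw [Fintype.sum_prod_type]
          simp only [Finset.sum_const, Finset.card_univ, nsmul_eq_mul]
          rw [Finset.mul_sum]
      _ ≤ Npp * (4 * (Real.sqrt (Ld * P.L) * Real.sqrt ((P.L : ℝ) * S))) := by
          refine mul_le_mul_of_nonneg_left ?_ hNpp0.le
          calc ∑ r, |squareSum a y (off r) μ ν|
              ≤ ∑ r, ((∑ s ∈ Finset.range P.L, |a (φ1 r s)|) + (∑ s ∈ Finset.range P.L, |a (φ2 r s)|) +
                  (∑ s ∈ Finset.range P.L, |a (φ3 r s)|) + (∑ s ∈ Finset.range P.L, |a (φ4 r s)|)) :=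
                Finset.sum_le_sum fun r _ => hsq r
            _ = (∑ r, ∑ s ∈ Finset.range P.L, |a (φ1 r s)|) + (∑ r, ∑ s ∈ Finset.range P.L, |a (φ2 r s)|) +
                  (∑ r, ∑ s ∈ Finset.range P.L, |a (φ3 r s)|) + (∑ r, ∑ s ∈ Finset.range P.L, |a (φ4 r s)|) := by
                simp only [Finset.sum_add_distrib]
            _ ≤ 4 * (Real.sqrt (Ld * P.L) * Real.sqrt ((P.L : ℝ) * S)) := by linarith [hF1, hF2, hF3, hF4]
  -- constants: `card⁻¹ · Npp · 4 · √(Ld L) · √(L S) = 4 · √(L²/Ld) · √S`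
  have hI0 : (0 : ℝ) < Fintype.card (Idx P) := by rw [hcard]; positivity
  rw [abs_mul, abs_inv, abs_of_pos hI0, hcard]
  have hkey : (Ld * Npp)⁻¹ * (Npp * (4 * (Real.sqrt (Ld * P.L) * Real.sqrt ((P.L : ℝ) * S)))) =
      4 * Real.sqrt ((P.L : ℝ) ^ 2 / Ld) * Real.sqrt S := by
    have e1 : Real.sqrt (Ld * P.L) * Real.sqrt ((P.L : ℝ) * S) = Real.sqrt Ld * (P.L : ℝ) * Real.sqrt S := by
      rw [Real.sqrt_mul hLd0.le, Real.sqrt_mul hL0.le]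
      have : Real.sqrt (P.L : ℝ) * Real.sqrt (P.L : ℝ) = P.L := Real.mul_self_sqrt hL0.le
      calc Real.sqrt Ld * Real.sqrt ↑P.L * (Real.sqrt ↑P.L * Real.sqrt S)
          = Real.sqrt Ld * (Real.sqrt ↑P.L * Real.sqrt ↑P.L) * Real.sqrt S := by ring
        _ = Real.sqrt Ld * (P.L : ℝ) * Real.sqrt S := by rw [this]
    have e2 : Real.sqrt ((P.L : ℝ) ^ 2 / Ld) = (P.L : ℝ) / Real.sqrt Ld := by
      rw [Real.sqrt_div (sq_nonneg _), Real.sqrt_sq hL0.le]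
    have hsL : 0 < Real.sqrt Ld := Real.sqrt_pos.mpr hLd0
    have e3 : (Ld)⁻¹ = (Real.sqrt Ld)⁻¹ * (Real.sqrt Ld)⁻¹ := by
      rw [← mul_inv, Real.mul_self_sqrt hLd0.le]
    rw [e1, e2, mul_inv, div_eq_mul_inv]
    field_simp
    rw [Real.sq_sqrt hLd0.le]
  calc (Ld * Npp)⁻¹ * |∑ i : Idx P, squareSum a y (off i.1) μ ν|
      ≤ (Ld * Npp)⁻¹ * (Npp * (4 * (Real.sqrt (Ld * P.L) * Real.sqrt ((P.L : ℝ) * S)))) :=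
        mul_le_mul_of_nonneg_left hsum (by positivity)
    _ = 4 * Real.sqrt ((P.L : ℝ) ^ 2 / Ld) * Real.sqrt S := hkey


/-! ## §4  The iterate: the j-UNIFORM Schur bound through the closed form `tubeSum − cobd` -/

/-- The level-`k` block parametrisation `r ↦ bsite k y r` is injective (standing range). [folklore] -/
theorem bsite_injective {k : ℕ} (hk : k ≤ P.m + P.K) (y : Site P k) :
    Function.Injective (bsite k y : (Fin P.d → Fin (P.L ^ k)) → Site P 0) := by
  intro r r' h
  funext κ
  apply Fin.ext
  have h1 := congrArg (fun z : Site P 0 => (z κ).val) h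
  simp only [val_bsite hk] at h1
  omega

/-- One tube family: `|tubeSum k a ⟨X, κ⟩| ≤ √((L^k)^d·L^k)·√(L^k·Σ_b a_b²)` (Cauchy–Schwarz + multiplicity `≤ L^k`). [folklore] -/
theorem abs_tubeSum_le_sqrt {k : ℕ} (hk : k ≤ P.m + P.K) (a : PBond P 0 → ℝ) (X : Site P k) (κ : Fin P.d) :
    |tubeSum k a ⟨X, κ⟩| ≤ Real.sqrt (((P.L : ℝ) ^ k) ^ P.d * (P.L ^ k : ℕ)) *
      Real.sqrt (((P.L ^ k : ℕ) : ℝ) * ∑ b : PBond P 0, a b ^ 2) := by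
  -- injectivity of the family in the offset at fixed position
  have hinj : ∀ s : ℕ, Function.Injective fun r : Fin P.d → Fin (P.L ^ k) => (⟨shiftN (bsite k X r) κ s, κ⟩ : PBond P 0) := by
    intro s
    have shiftN_injective : Function.Injective fun x : Site P 0 => shiftN x κ s := by
      intro x x' h
      funext ι
      have h1 := congrArg (fun z : Site P 0 => z ι) h
      simp only [shiftN_apply] at h1
      exact add_right_cancel h1
    exact (bond_mk_injective κ).comp (shiftN_injective.comp (bsite_injective hk X))
  have h := sum_sum_abs_le_sqrt a (fun (r : Fin P.d → Fin (P.L ^ k)) (s : ℕ) => (⟨shiftN (bsite k X r) κ s, κ⟩ : PBond P 0))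
    hinj (P.L ^ k)
  have hcard : (Fintype.card (Fin P.d → Fin (P.L ^ k)) : ℝ) = ((P.L : ℝ) ^ k) ^ P.d := by
    rw [Fintype.card_fun, Fintype.card_fin, Fintype.card_fin]; push_cast; ring
  rw [hcard] at h
  refine le_trans ?_ h
  -- `|Σ_r Σ_{t : Fin (L^k)} a| ≤ Σ_r Σ_{s < L^k} |a|`
  unfold tubeSum
  refine (Finset.abs_sum_le_sum_abs _ _).trans (Finset.sum_le_sum fun r _ => ?_)
  rw [← Fin.sum_univ_eq_sum_range (fun s => |a ⟨shiftN (bsite k X r) κ s, κ⟩|) (P.L ^ k)]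
  exact Finset.abs_sum_le_sum_abs _ _

/-- **★★ THE j-UNIFORM SCHUR BOUND FOR THE ITERATED (0.4) LINEAR AVERAGE.**  For every finest one-form `a`, every level
`k ≤ m + K`, and every level-`k` plaquette `(Y; μ, ν)`:
`|curl(linAvgIter k a)(Y; μ, ν)| ≤ 4·√((L^k)²/(L^k)^d)·(Σ_b a_b²)^{1/2}` — the SAME constant `4` at every depth (d = 3:
`4·L^{−k/2}`).  Proof: the tree's closed form `linAvgIter k a = (L^k)^{−d}·tubeSum k a − cobd Φ`
(✓`AbelianEML.linAvgIter_eq_tubeSum_sub_cobd`); the curl kills the coboundary; the four tube sums around the plaquette are the four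
side families of the `(L^k)^d` translated `L^k × L^k` squares, each bounded by `abs_tubeSum_le_sqrt`. [folklore] -/
theorem abs_curlAt_linAvgIter_le_sqrt {k : ℕ} (hk : k ≤ P.m + P.K) (a : PBond P 0 → ℝ) (Y : Site P k) (μ ν : Fin P.d) :
    |curlAt (linAvgIter k a) Y μ ν| ≤
      4 * Real.sqrt (((P.L : ℝ) ^ k) ^ 2 / ((P.L : ℝ) ^ k) ^ P.d) * Real.sqrt (∑ b : PBond P 0, a b ^ 2) := by
  obtain ⟨Φ, hΦ⟩ := linAvgIter_eq_tubeSum_sub_cobd hk a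
  set Ld : ℝ := ((P.L : ℝ) ^ k) ^ P.d with hLd
  set M : ℝ := ((P.L ^ k : ℕ) : ℝ) with hM
  set S : ℝ := ∑ b : PBond P 0, a b ^ 2 with hS
  have hL0 : (0 : ℝ) < P.L := by exact_mod_cast P.L_pos
  have hM0 : 0 < M := by rw [hM]; exact_mod_cast pow_pos P.L_pos k
  have hMe : M = (P.L : ℝ) ^ k := by rw [hM]; push_cast; ring
  have hLd0 : 0 < Ld := by rw [hLd]; positivity
  have hS0 : 0 ≤ S := Finset.sum_nonneg fun b _ => sq_nonneg _
  -- the curl kills the coboundary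
  have hcurl : curlAt (linAvgIter k a) Y μ ν =
      Ld⁻¹ * (tubeSum k a ⟨Y, μ⟩ + tubeSum k a ⟨Y.shift μ, ν⟩ - tubeSum k a ⟨Y.shift ν, μ⟩ - tubeSum k a ⟨Y, ν⟩) := by
    simp only [curlAt, hΦ, cobd, PBond.tgt]
    rw [shift_shift_comm Y μ ν]
    ring
  rw [hcurl, abs_mul, abs_inv, abs_of_pos hLd0]
  have h1 := abs_tubeSum_le_sqrt hk a Y μ
  have h2 := abs_tubeSum_le_sqrt hk a (Y.shift μ) ν
  have h3 := abs_tubeSum_le_sqrt hk a (Y.shift ν) μ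
  have h4 := abs_tubeSum_le_sqrt hk a Y ν
  have habs : |tubeSum k a ⟨Y, μ⟩ + tubeSum k a ⟨Y.shift μ, ν⟩ - tubeSum k a ⟨Y.shift ν, μ⟩ - tubeSum k a ⟨Y, ν⟩| ≤
      4 * (Real.sqrt (Ld * M) * Real.sqrt (M * S)) := by
    have : ∀ A B C D : ℝ, |A + B - C - D| ≤ |A| + |B| + |C| + |D| := fun A B C D => by
      have := abs_add_le (A + B - C) (-D)
      have := abs_add_le (A + B) (-C)
      have := abs_add_le A B
      simp only [abs_neg, ← sub_eq_add_neg] at *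
      linarith
    have e := this (tubeSum k a ⟨Y, μ⟩) (tubeSum k a ⟨Y.shift μ, ν⟩) (tubeSum k a ⟨Y.shift ν, μ⟩) (tubeSum k a ⟨Y, ν⟩)
    have hLdM : Real.sqrt (((P.L : ℝ) ^ k) ^ P.d * (P.L ^ k : ℕ)) * Real.sqrt (((P.L ^ k : ℕ) : ℝ) * ∑ b : PBond P 0, a b ^ 2)
        = Real.sqrt (Ld * M) * Real.sqrt (M * S) := by rw [hLd, hM, hS]
    rw [hLdM] at h1 h2 h3 h4
    linarith
  -- constants: `Ld⁻¹ · 4 · √(Ld M) · √(M S) = 4 · √(M²/Ld) · √S`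
  have hkey : Ld⁻¹ * (4 * (Real.sqrt (Ld * M) * Real.sqrt (M * S))) = 4 * Real.sqrt (M ^ 2 / Ld) * Real.sqrt S := by
    have e1 : Real.sqrt (Ld * M) * Real.sqrt (M * S) = Real.sqrt Ld * M * Real.sqrt S := by
      rw [Real.sqrt_mul hLd0.le, Real.sqrt_mul hM0.le]
      have : Real.sqrt M * Real.sqrt M = M := Real.mul_self_sqrt hM0.le
      calc Real.sqrt Ld * Real.sqrt M * (Real.sqrt M * Real.sqrt S)
          = Real.sqrt Ld * (Real.sqrt M * Real.sqrt M) * Real.sqrt S := by ring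
        _ = Real.sqrt Ld * M * Real.sqrt S := by rw [this]
    have e2 : Real.sqrt (M ^ 2 / Ld) = M / Real.sqrt Ld := by
      rw [Real.sqrt_div (sq_nonneg _), Real.sqrt_sq hM0.le]
    have hsL : 0 < Real.sqrt Ld := Real.sqrt_pos.mpr hLd0
    rw [e1, e2, div_eq_mul_inv]
    field_simp
    rw [Real.sq_sqrt hLd0.le]
  calc Ld⁻¹ * |tubeSum k a ⟨Y, μ⟩ + tubeSum k a ⟨Y.shift μ, ν⟩ - tubeSum k a ⟨Y.shift ν, μ⟩ - tubeSum k a ⟨Y, ν⟩|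
      ≤ Ld⁻¹ * (4 * (Real.sqrt (Ld * M) * Real.sqrt (M * S))) := mul_le_mul_of_nonneg_left habs (by positivity)
    _ = 4 * Real.sqrt (M ^ 2 / Ld) * Real.sqrt S := hkey
    _ = 4 * Real.sqrt (((P.L : ℝ) ^ k) ^ 2 / Ld) * Real.sqrt S := by rw [hMe]

end Summit.QuantumFields.YangMills.Theorems.PoincareLipschitzLinAvgEll2

end
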